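import Summits.ValiantsHypothesis.ValiantsHypothesis.Theorems.LacunarySymmetroidMatrixDescartesDoorA26WallBubblingOnePairWallClosure

/-!
# Wall bubbling for `DoorA26` — THE VALUE-GENERIC DEEP STRATUM `Stmt.weylFaces_deepVal` REDUCED TO THE TWO- AND THREE-PAIR CHAINS AND THE TRIPLES (bookkeeping)

HONEST FRAMING.  Obligation (W) `stub_weylFaces` of `Cruxes/DoorA26/Lines/wall_bubbling.lean` (crux `DoorA26`, stmt-ValiantsHypothesis-19979; OPEN,
typed, never asserted); statement file `Cruxes/DoorA26/Lines/wall_bubbling_ConfluentDoor.lean` rev 5d,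
`Stmt.weylFaces_deepVal := ∀ δ ∈ SortedSimplex, HasWeylCoincidence δ → IsValueGeneric δ → (∀ i j, ¬ IsGenericWeylFace δ i j) → δ ∉ closure TwentyLocus`.
W1 seat val-sym-door-p2 g13 (#44).  THIS FILE is the kernel form of the stratification of (W_deepVal): with the rev-5d predicates INLINED VERBATIM,
**`weylFaces_deepVal_of_chains (hVG2) (hVG3) (hT) : <Stmt.weylFaces_deepVal inlined>`**, where

* `hVG2` = «no sequence of genuine `(2,6)` pencils with twenty log-zeros at every stage has exponents converging to a VALUE-GENERIC TWO-WEYL-PAIR point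
  (`δ0 5 = δ0 0`, `δ0 4 = δ0 1`, `hvg` as in W1 #26 `doublyConfluentDet_ne_zero_of_polar_ne_zero`)» — the two-pair tight chain (single-cluster branch
  = W1 #28 `no_twenty_window_twoWeylPairs`; multi-cluster needs two-dslope rungs; OPEN);
* `hVG3` = the same at a VALUE-GENERIC THREE-PAIR point (`δ0 3 = δ0 2` too, `hvg` as in W1 #32) — single-cluster branch W1 #33; OPEN;
* `hT` = «a value-generic point of the sorted simplex with a TRIPLE `δ_i = δ_j = δ_k` is not a limit of twenties» (closure currency; needs the anatomy of
  the triple frame — the cancelling Gram pattern `2E_ac − E_bb` is realisable, W1 g13 notes; OPEN, untouched).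

PROOF (bookkeeping): a triple → `hT`; else every coincidence class has two letters.  One pair only ⇒ the face IS generic (`IsGenericWeylFace δ i j`:
`InjOn` of the pair sums off `j` from `IsValueGeneric` and the injectivity of the values off `j`) — excluded by hypothesis.  Otherwise a second, DISJOINT
pair `{k,l}`; the fifth and sixth letters `m, n` by counting (`{i,j,k,l,m,n} = univ`); the relabelling `g = ![i,k,m,n,l,j]` is injective (`injective_vec6`),
sums are reindexed (`Fintype.sum_bijective`); if `δ m = δ n` the three values `δ i, δ k, δ m` are distinct (no triple) and `IsValueGeneric` gives the
`Fin 3`-`hvg`, so `hVG3` ends it; else the four values `δ i, δ k, δ m, δ n` are distinct and `hVG2` ends it.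

So `Stmt.weylFaces_deepVal` ⟸ hVG2 ∧ hVG3 ∧ hT, kernel-checked, door-free; all three OPEN.  Registers unchanged; (W), `ConfluentDoor26`,
`NoTightChain26(NC)`, `DoorA26` 19979, 18050 OPEN, typed never asserted; nothing on VP ≠ VNP.  Def-free.  `--supports stmt-ValiantsHypothesis-19979 --as helper`.
-/

-- `Summit.ValiantsHypothesis.ValiantsHypothesis.…` repeats a component by the D-0017 layout
-- (single-conjunct summit), which the `dupNamespace` linter flags; the name is mandated.
set_option linter.dupNamespace false

namespace Summit.ValiantsHypothesis.ValiantsHypothesis.Theorems.LacunarySymmetroidMatrixDescartes.WallBubbling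

open Finset Filter Topology
open Bubbling (polar TwentyLocus SortedSimplex)
open scoped BigOperators

/-- **`Stmt.weylFaces_deepVal` REDUCES TO THE VALUE-GENERIC TWO- AND THREE-PAIR CHAINS AND THE TRIPLE STRATA** (rev-5d predicates inlined verbatim;
`SortedSimplex`, `TwentyLocus` the Theorems-side copies); see the module docstring. [this work] -/
theorem weylFaces_deepVal_of_chains
    (hVG2 : ∀ (δs : ℕ → Fin 6 → ℝ) (δ0 : Fin 6 → ℝ), (∀ l, Tendsto (fun ν => δs ν l) atTop (𝓝 (δ0 l))) →
      δ0 5 = δ0 0 → δ0 4 = δ0 1 →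
      (∀ a b c d : Fin 4, δ0 a.castSucc.castSucc + δ0 b.castSucc.castSucc = δ0 c.castSucc.castSucc + δ0 d.castSucc.castSucc →
        (a = c ∧ b = d) ∨ (a = d ∧ b = c)) →
      ∀ (U : ℕ → Fin 6 → Matrix (Fin 2) (Fin 2) ℝ), (∀ ν l, (U ν l).IsSymm) →
      (∀ ν, ∃ t, (∑ l, Real.exp (δs ν l * t) • U ν l).det ≠ 0) →
      ∀ (z : ℕ → Fin 20 → ℝ), (∀ ν, StrictMono (z ν)) → (∀ ν i, (∑ l, Real.exp (δs ν l * z ν i) • U ν l).det = 0) → False)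
    (hVG3 : ∀ (δs : ℕ → Fin 6 → ℝ) (δ0 : Fin 6 → ℝ), (∀ l, Tendsto (fun ν => δs ν l) atTop (𝓝 (δ0 l))) →
      δ0 5 = δ0 0 → δ0 4 = δ0 1 → δ0 3 = δ0 2 →
      (∀ a b c e : Fin 3, δ0 a.castSucc.castSucc.castSucc + δ0 b.castSucc.castSucc.castSucc
          = δ0 c.castSucc.castSucc.castSucc + δ0 e.castSucc.castSucc.castSucc → (a = c ∧ b = e) ∨ (a = e ∧ b = c)) →
      ∀ (U : ℕ → Fin 6 → Matrix (Fin 2) (Fin 2) ℝ), (∀ ν l, (U ν l).IsSymm) →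
      (∀ ν, ∃ t, (∑ l, Real.exp (δs ν l * t) • U ν l).det ≠ 0) →
      ∀ (z : ℕ → Fin 20 → ℝ), (∀ ν, StrictMono (z ν)) → (∀ ν i, (∑ l, Real.exp (δs ν l * z ν i) • U ν l).det = 0) → False)
    (hT : ∀ δ ∈ SortedSimplex, (∃ i j k : Fin 6, i ≠ j ∧ i ≠ k ∧ j ≠ k ∧ δ i = δ j ∧ δ i = δ k) →
      (∀ a b c d : Fin 6, δ a + δ b = δ c + δ d → (δ a = δ c ∧ δ b = δ d) ∨ (δ a = δ d ∧ δ b = δ c)) →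
      δ ∉ closure TwentyLocus) :
    ∀ δ ∈ SortedSimplex, (∃ i j : Fin 6, i ≠ j ∧ δ i = δ j) →
      (∀ a b c d : Fin 6, δ a + δ b = δ c + δ d → (δ a = δ c ∧ δ b = δ d) ∨ (δ a = δ d ∧ δ b = δ c)) →
      (∀ i j : Fin 6, ¬ (i < j ∧ δ i = δ j ∧
        Set.InjOn (fun p : Fin 5 × Fin 5 => δ (j.succAbove p.1) + δ (j.succAbove p.2)) {p | p.1 ≤ p.2})) →
      δ ∉ closure TwentyLocus := by
  intro δ hδS hW hV hng
  by_cases htr : ∃ i j k : Fin 6, i ≠ j ∧ i ≠ k ∧ j ≠ k ∧ δ i = δ j ∧ δ i = δ k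
  · exact hT δ hδS htr hV
  intro hcl
  classical
  -- no triple
  have hT' : ∀ i j k : Fin 6, i ≠ j → i ≠ k → j ≠ k → δ i = δ j → δ i ≠ δ k :=
    fun i j k hij hik hjk h1 h2 => htr ⟨i, j, k, hij, hik, hjk, h1, h2⟩
  -- a sorted pair
  obtain ⟨i, j, hlt, hδij⟩ : ∃ i j : Fin 6, i < j ∧ δ i = δ j := by
    obtain ⟨i, j, hij, h⟩ := hW
    rcases hij.lt_or_gt with h' | h'
    · exact ⟨i, j, h', h⟩
    · exact ⟨j, i, h', h.symm⟩
  have hij : i ≠ j := ne_of_lt hlt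
  -- (0) entrance
  obtain ⟨δseq, hmem, hlim⟩ := mem_closure_iff_seq_limit.mp hcl
  choose S hS hneS z hz hroot using fun ν => twenty_log_zeros_of_mem_twentyLocus (hmem ν)
  have hδ : ∀ l, Tendsto (fun ν => δseq ν l) atTop (𝓝 (δ l)) := fun l => (tendsto_pi_nhds.mp hlim) l
  -- reindexing along an injective relabelling
  have reindex : ∀ g : Fin 6 → Fin 6, Function.Injective g →
      (∀ ν, ∃ t, (∑ k, Real.exp (δseq ν (g k) * t) • S ν (g k)).det ≠ 0) ∧
      (∀ ν i, (∑ k, Real.exp (δseq ν (g k) * z ν i) • S ν (g k)).det = 0) := by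
    intro g hg
    have hbij : Function.Bijective g := Finite.injective_iff_bijective.mp hg
    have hsumg : ∀ F : Fin 6 → Matrix (Fin 2) (Fin 2) ℝ, ∑ k, F (g k) = ∑ l, F l :=
      fun F => Fintype.sum_bijective g hbij (fun k => F (g k)) F (fun _ => rfl)
    refine ⟨fun ν => ?_, fun ν i' => ?_⟩
    · obtain ⟨t, ht⟩ := hneS ν
      exact ⟨t, by rw [hsumg (fun l => Real.exp (δseq ν l * t) • S ν l)]; exact ht⟩
    · rw [hsumg (fun l => Real.exp (δseq ν l * z ν i') • S ν l)]
      exact hroot ν i'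
  by_cases hone : ∀ k l : Fin 6, k ≠ l → δ k = δ l → k = i ∨ k = j
  · -- (1) ONE pair only: the face is generic — excluded
    have hval : ∀ k l : Fin 6, δ k = δ l → k = l ∨ (k = i ∧ l = j) ∨ (k = j ∧ l = i) := by
      intro k l hkl
      by_cases hkl' : k = l
      · exact Or.inl hkl'
      rcases hone k l hkl' hkl with hk | hk <;> rcases hone l k (Ne.symm hkl') hkl.symm with hl | hl
      · exact absurd (hk.trans hl.symm) hkl'
      · exact Or.inr (Or.inl ⟨hk, hl⟩)
      · exact Or.inr (Or.inr ⟨hk, hl⟩)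
      · exact absurd (hk.trans hl.symm) hkl'
    have hsA : ∀ x y : Fin 5, δ (j.succAbove x) = δ (j.succAbove y) → x = y := by
      intro x y h
      rcases hval _ _ h with h' | ⟨-, h'⟩ | ⟨h', -⟩
      · exact Fin.succAbove_right_injective h'
      · exact absurd h' (Fin.succAbove_ne j y)
      · exact absurd h' (Fin.succAbove_ne j x)
    refine hng i j ⟨hlt, hδij, ?_⟩
    intro p hp q hq hpq
    simp only [Set.mem_setOf_eq] at hp hq
    rcases hV _ _ _ _ hpq with ⟨h1, h2⟩ | ⟨h1, h2⟩
    · exact Prod.ext (hsA _ _ h1) (hsA _ _ h2)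
    · have e1 := hsA _ _ h1
      have e2 := hsA _ _ h2
      have h12 : p.1 = p.2 := le_antisymm hp (by rw [← e2, ← e1] at hq; exact hq)
      exact Prod.ext (by rw [← e2, h12]) (by rw [← e1, h12])
  -- (2) a second, disjoint pair `{k, l}`
  push Not at hone
  obtain ⟨k, l, hkl, hδkl, hki, hkj⟩ := hone
  have hli : l ≠ i := fun h => hT' k i j hki hkj hij (by rw [h] at hδkl; exact hδkl) (by rw [h] at hδkl; rw [hδkl, hδij])
  have hlj : l ≠ j := fun h => hT' k j i hkj hki hij.symm (by rw [h] at hδkl; exact hδkl) (by rw [h] at hδkl; rw [hδkl, hδij])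
  have hvik : δ i ≠ δ k := fun h => hT' i j k hij (Ne.symm hki) (Ne.symm hkj) hδij h
  -- the fifth and sixth letters
  obtain ⟨m, hm⟩ : ∃ m : Fin 6, m ∉ ({i, j, k, l} : Finset (Fin 6)) := by
    have hlt' : ({i, j, k, l} : Finset (Fin 6)).card < (Finset.univ : Finset (Fin 6)).card :=
      lt_of_le_of_lt Finset.card_le_four (by rw [Finset.card_univ, Fintype.card_fin]; norm_num)
    obtain ⟨m, -, hm⟩ := Finset.exists_mem_notMem_of_card_lt_card hlt'
    exact ⟨m, hm⟩
  obtain ⟨n, hn⟩ : ∃ n : Fin 6, n ∉ ({i, j, k, l, m} : Finset (Fin 6)) := by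
    have hlt' : ({i, j, k, l, m} : Finset (Fin 6)).card < (Finset.univ : Finset (Fin 6)).card :=
      lt_of_le_of_lt Finset.card_le_five (by rw [Finset.card_univ, Fintype.card_fin]; norm_num)
    obtain ⟨n, -, hn⟩ := Finset.exists_mem_notMem_of_card_lt_card hlt'
    exact ⟨n, hn⟩
  simp only [Finset.mem_insert, Finset.mem_singleton, not_or] at hm hn
  obtain ⟨hmi, hmj, hmk, hml⟩ := hm
  obtain ⟨hni, hnj, hnk, hnl, hnm⟩ := hn
  -- values: `δ i, δ k, δ m` pairwise distinct, `δ n ∉ {δ i, δ k}` (no triple)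
  have hvim : δ i ≠ δ m := fun h => hT' i j m hij (Ne.symm hmi) (Ne.symm hmj) hδij h
  have hvkm : δ k ≠ δ m := fun h => hT' k l m hkl (Ne.symm hmk) (Ne.symm hml) hδkl h
  have hvin : δ i ≠ δ n := fun h => hT' i j n hij (Ne.symm hni) (Ne.symm hnj) hδij h
  have hvkn : δ k ≠ δ n := fun h => hT' k l n hkl (Ne.symm hnk) (Ne.symm hnl) hδkl h
  -- the relabelling
  have hg : Function.Injective ![i, k, m, n, l, j] :=
    injective_vec6 i k m n l j (Ne.symm hki) (Ne.symm hmi) (Ne.symm hni) (Ne.symm hli) hij (Ne.symm hmk) (Ne.symm hnk) hkl hkj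
      (Ne.symm hnm) hml hmj hnl hnj hlj
  obtain ⟨hne', hroot'⟩ := reindex _ hg
  have h4 : ∀ x : Fin 4, x = 0 ∨ x = 1 ∨ x = 2 ∨ x = 3 := by decide
  have h3 : ∀ x : Fin 3, x = 0 ∨ x = 1 ∨ x = 2 := by decide
  by_cases hvmn : δ m = δ n
  · -- (3) THREE value-generic pairs
    have hinj3 : ∀ x y : Fin 3, δ (![i, k, m, n, l, j] x.castSucc.castSucc.castSucc) = δ (![i, k, m, n, l, j] y.castSucc.castSucc.castSucc) →
        x = y := by
      intro x y hxy
      rcases h3 x with rfl | rfl | rfl <;> rcases h3 y with rfl | rfl | rfl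
      all_goals first
        | rfl
        | exact absurd hxy hvik | exact absurd hxy.symm hvik | exact absurd hxy hvim | exact absurd hxy.symm hvim
        | exact absurd hxy hvkm | exact absurd hxy.symm hvkm
    refine hVG3 (fun ν q => δseq ν (![i, k, m, n, l, j] q)) (fun q => δ (![i, k, m, n, l, j] q)) (fun q => hδ _)
      hδij.symm hδkl.symm hvmn.symm ?_ (fun ν q => S ν (![i, k, m, n, l, j] q)) (fun ν q => hS ν _) hne' z hz hroot'
    intro a b c e h
    rcases hV _ _ _ _ h with ⟨h1, h2⟩ | ⟨h1, h2⟩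
    · exact Or.inl ⟨hinj3 _ _ h1, hinj3 _ _ h2⟩
    · exact Or.inr ⟨hinj3 _ _ h1, hinj3 _ _ h2⟩
  · -- (4) TWO value-generic pairs
    have hinj4 : ∀ x y : Fin 4, δ (![i, k, m, n, l, j] x.castSucc.castSucc) = δ (![i, k, m, n, l, j] y.castSucc.castSucc) → x = y := by
      intro x y hxy
      rcases h4 x with rfl | rfl | rfl | rfl <;> rcases h4 y with rfl | rfl | rfl | rfl
      all_goals first
        | rfl
        | exact absurd hxy hvik | exact absurd hxy.symm hvik | exact absurd hxy hvim | exact absurd hxy.symm hvim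
        | exact absurd hxy hvin | exact absurd hxy.symm hvin | exact absurd hxy hvkm | exact absurd hxy.symm hvkm
        | exact absurd hxy hvkn | exact absurd hxy.symm hvkn | exact absurd hxy hvmn | exact absurd hxy.symm hvmn
    refine hVG2 (fun ν q => δseq ν (![i, k, m, n, l, j] q)) (fun q => δ (![i, k, m, n, l, j] q)) (fun q => hδ _)
      hδij.symm hδkl.symm ?_ (fun ν q => S ν (![i, k, m, n, l, j] q)) (fun ν q => hS ν _) hne' z hz hroot'
    intro a b c e h
    rcases hV _ _ _ _ h with ⟨h1, h2⟩ | ⟨h1, h2⟩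
    · exact Or.inl ⟨hinj4 _ _ h1, hinj4 _ _ h2⟩
    · exact Or.inr ⟨hinj4 _ _ h1, hinj4 _ _ h2⟩

end Summit.ValiantsHypothesis.ValiantsHypothesis.Theorems.LacunarySymmetroidMatrixDescartes.WallBubbling
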